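import Summits.NavierStokesRegularity.TurbBounds.CouplingSplit
import HarnessLib

/-!
# Row RB-N0 tail lemma — the exact coupling `couplingMode 8 0 0` of the conduction profile (`P = 0`: `Λ(n,m,0) = w_n·[n = m]`)
(cell `pub-turb` / `turb-bounds`; v2; GENERATED by HOME/pub-turb-cert/lean-tail-v2/tailgen/emit/emit_rb.py; straight from the definition of `tripleCoeff`.)

HONEST FRAMING: rigorous bounds for the stated PDE and boundary conditions; no claim about physical turbulence beyond the bound.
-/

set_option linter.style.longLine false
set_option linter.style.setOption false

noncomputable section

namespace Summit.NavierStokesRegularity.TurbBounds.TailN0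

open Finset
open Summit.NavierStokesRegularity.TurbBounds.LadderTail (w)
open Summit.NavierStokesRegularity.TurbBounds.LegendreTriple (tripleCoeff)
open Summit.NavierStokesRegularity.TurbBounds.CouplingSplit (couplingMode)

set_option maxRecDepth 100000 in
set_option maxHeartbeats 20000000 in
/-- `couplingMode 8 0 0 b e = Σ_{n ≤ 8} w_n b_n e_n`. -/
theorem couplingMode_0_eq (b e : ℕ → ℝ) :
    couplingMode 8 0 0 b e = (2 : ℝ) * (b 0 * e 0) + (2/3 : ℝ) * (b 1 * e 1) + (2/5 : ℝ) * (b 2 * e 2) + (2/7 : ℝ) * (b 3 * e 3) + (2/9 : ℝ) * (b 4 * e 4) + (2/11 : ℝ) * (b 5 * e 5) + (2/13 : ℝ) * (b 6 * e 6) + (2/15 : ℝ) * (b 7 * e 7) + (2/17 : ℝ) * (b 8 * e 8) := by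
  unfold couplingMode
  simp (maxSteps := 20000000) only [sum_range_succ, sum_range_zero, zero_add]
  norm_num [tripleCoeff, w]
  ring

end Summit.NavierStokesRegularity.TurbBounds.TailN0

end
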